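import Summits.MatrixMultiplication.MatrixMultiplication.Theorems.FarEdgeDescentNearVertex
import HarnessLib

/-!
# Route `FarEdgeDescent` — near-vertex cut, instrument: the corner slope at `α` against the VXXZ table

Support module (def-free), companion of `FarEdgeDescentNearVertex` (gen 23, Part I).  The near-vertex
dichotomy says `ω(ℂ) > 2` iff the convex profile `f(x) = ω(1,x,1)` leaves its floor `2` at
`α = dualExponentAlpha ℂ < 1` with a CORNER (right derivative `κ₀ := ∂⁺f(α) > 0`) or TANGENTIALLY (`κ₀ = 0`).
This file prices the corner against published rectangular upper bounds: since the right derivative at `α` is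
below every secant slope to the right (`rightDeriv_le_slope`, convexity),
`κ₀ · (κ − α) ≤ ω(1,κ,1) − 2 ≤ b − 2` for every row `(κ, b)` of Table 1 of Vassilevska Williams–Xu–Xu–Zhou
(named fact `vxxz2024_omegaRect_table`, hypothesis) with `κ > α` (`rightDeriv_alpha_le_of_row`), and the same
for the slope `s` of any supporting corner line (`corner_slope_le_of_row`).  Instances: EITHER `α ≥ 0.33` OR
`κ₀ ≤ 10⁻⁴/(0.33 − α)`; either `α ≥ 0.35` or `κ₀ ≤ 0.001363/(0.35 − α)`; unconditionally in `α`,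
`κ₀ ≤ 0.042994/(0.5 − α)` when `α < 1/2` and `κ₀ (1 − α) ≤ ω − 2` (Part I).  Reading (instrument, not a claim
about the true profile's type): the method envelope of Table 1 leaves the floor at `κ = 0.321334` with local
exponents `2.34, 1.91, 1.93, 1.86, 1.80` between consecutive rows `0.33 … 0.50` — a TANGENTIAL-type departure —
so a true corner inside the certified window is blunt to within the table's resolution.

Placement [cite: VassilevskaWilliamsXuXuZhou2024, §1.1 Table 1] [cite: LottiRomani1983, Prop. 4.1].
Written by the decomp-mm lens-2 planner seat (gen 23); imports only BUILT modules; no new definitions.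
-/

set_option linter.dupNamespace false

noncomputable section

namespace Summit.MatrixMultiplication.MatrixMultiplication.Theorems.FarEdgeDescentNearCornerPrice

open Literature.Computability.AlgebraicComplexity
open Summit.MatrixMultiplication.MatrixMultiplication.Theorems.FarEdgeDescentNearVertex
open Set

/-- The right derivative at `α` is below the secant slope to any shape `κ > α`:
`κ₀ · (κ − α) ≤ ω(1,κ,1) − 2`. -/
theorem rightDeriv_alpha_mul_le {κ : ℝ} (hκ : dualExponentAlpha ℂ < κ) :
    derivWithin (fun y : ℝ => omegaRect ℂ 1 y 1) (Ioi (dualExponentAlpha ℂ)) (dualExponentAlpha ℂ) *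
        (κ - dualExponentAlpha ℂ) ≤ omegaRect ℂ 1 κ 1 - 2 := by
  have h := rightDeriv_le_slope hκ
  rw [slope_def_field, omegaRect_dualExponentAlpha, le_div_iff₀ (sub_pos.2 hκ)] at h
  exact h

/-- ★ **Corner price from a table row**: under the named fact `vxxz2024_omegaRect_table`, for every row
`(κ, b)` with `κ > α`: `κ₀ ≤ (b − 2)/(κ − α)`. -/
theorem rightDeriv_alpha_le_of_row (h : vxxz2024_omegaRect_table) {κ b : ℝ} (hrow : (κ, b) ∈ vxxz2024Table)
    (hκ : dualExponentAlpha ℂ < κ) :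
    derivWithin (fun y : ℝ => omegaRect ℂ 1 y 1) (Ioi (dualExponentAlpha ℂ)) (dualExponentAlpha ℂ) ≤
      (b - 2) / (κ - dualExponentAlpha ℂ) := by
  rw [le_div_iff₀ (sub_pos.2 hκ)]
  exact (rightDeriv_alpha_mul_le hκ).trans (by linarith [h κ b hrow])

/-- The same price for the slope `s` of ANY corner line `2 + s (x − α) ≤ f(x)` (the corner atom N2 of the
near-vertex dichotomy): `s · (κ − α) ≤ b − 2` for EVERY row `(κ, b)` (informative when `κ > α`). -/
theorem corner_slope_le_of_row (h : vxxz2024_omegaRect_table) {κ b : ℝ} (hrow : (κ, b) ∈ vxxz2024Table)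
    {s : ℝ} (hsup : ∀ x : ℝ, 2 + s * (x - dualExponentAlpha ℂ) ≤ omegaRect ℂ 1 x 1) :
    s * (κ - dualExponentAlpha ℂ) ≤ b - 2 := by
  have h1 := hsup κ
  have h2 := h κ b hrow
  linarith

/-- Instance (row `κ = 0.33`, `b = 2.0001`): EITHER the floor extends to `α ≥ 0.33`, OR the corner at `α` is
blunt: `κ₀ ≤ 10⁻⁴ / (0.33 − α)`. -/
theorem alpha_ge_or_rightDeriv_le_row033 (h : vxxz2024_omegaRect_table) :
    (0.33 : ℝ) ≤ dualExponentAlpha ℂ ∨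
      derivWithin (fun y : ℝ => omegaRect ℂ 1 y 1) (Ioi (dualExponentAlpha ℂ)) (dualExponentAlpha ℂ) ≤
        (2.000100 - 2) / (0.33 - dualExponentAlpha ℂ) := by
  rcases le_or_gt (0.33 : ℝ) (dualExponentAlpha ℂ) with hα | hα
  · exact Or.inl hα
  · exact Or.inr (rightDeriv_alpha_le_of_row h (by norm_num [vxxz2024Table]) hα)

/-- Instance (row `κ = 0.35`, `b = 2.001363`): either `α ≥ 0.35` or `κ₀ ≤ 0.001363 / (0.35 − α)`. -/
theorem alpha_ge_or_rightDeriv_le_row035 (h : vxxz2024_omegaRect_table) :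
    (0.35 : ℝ) ≤ dualExponentAlpha ℂ ∨
      derivWithin (fun y : ℝ => omegaRect ℂ 1 y 1) (Ioi (dualExponentAlpha ℂ)) (dualExponentAlpha ℂ) ≤
        (2.001363 - 2) / (0.35 - dualExponentAlpha ℂ) := by
  rcases le_or_gt (0.35 : ℝ) (dualExponentAlpha ℂ) with hα | hα
  · exact Or.inl hα
  · exact Or.inr (rightDeriv_alpha_le_of_row h (by norm_num [vxxz2024Table]) hα)

/-- Instance (row `κ = 0.5`, `b = 2.042994`): either `α ≥ 1/2` or `κ₀ ≤ 0.042994 / (0.5 − α)`. -/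
theorem alpha_ge_or_rightDeriv_le_row050 (h : vxxz2024_omegaRect_table) :
    (0.50 : ℝ) ≤ dualExponentAlpha ℂ ∨
      derivWithin (fun y : ℝ => omegaRect ℂ 1 y 1) (Ioi (dualExponentAlpha ℂ)) (dualExponentAlpha ℂ) ≤
        (2.042994 - 2) / (0.50 - dualExponentAlpha ℂ) := by
  rcases le_or_gt (0.50 : ℝ) (dualExponentAlpha ℂ) with hα | hα
  · exact Or.inl hα
  · exact Or.inr (rightDeriv_alpha_le_of_row h (by norm_num [vxxz2024Table]) hα)

/-- The square row (`κ = 1`, `b = 2.371552`) recovers a numerical near contact-angle price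
`κ₀ (1 − α) ≤ 0.371552` (cf. the hypothesis-free `rightDeriv_price : κ₀ (1 − α) ≤ ω − 2` of Part I). -/
theorem rightDeriv_alpha_mul_le_square (h : vxxz2024_omegaRect_table) :
    derivWithin (fun y : ℝ => omegaRect ℂ 1 y 1) (Ioi (dualExponentAlpha ℂ)) (dualExponentAlpha ℂ) *
        (1 - dualExponentAlpha ℂ) ≤ 0.371552 := by
  have h1 := rightDeriv_price
  have h2 := h 1 2.371552 (by norm_num [vxxz2024Table])
  rw [omegaRect_one_one_one] at h2
  linarith

end Summit.MatrixMultiplication.MatrixMultiplication.Theorems.FarEdgeDescentNearCornerPrice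

end
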